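import Literature.NumberTheory.GaloisRepresentations.ConjugationDescent
import HarnessLib

/-!
# The `G/N`-action on `H²(N, X)` of a TWISTED representation: `g · y = u · y` when `X ≅ X′ ⊗ χ` on `N` and `χ(g) = u`

Topic `Literature/NumberTheory/GaloisRepresentations`.  Cell `bsd-print-cf2`, width seat `bsd-line-cf2c-w8` g9: the TWIST step turning the local class
field theory input «`Gal(K̄_v/K_v)` acts trivially on `H²(Gal(K̄_v/L), μ_n)`» into the displayed local hypothesis of
`…ClassGroupRowCokernelLocal` / `Theorems/…JLKDescentRowOneCokernel` («`conj_δ` acts on `H²(·, μ_{p^k} ⊗ θ′)` as `θ′(δ)` once `θ′` is trivial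
on the subgroup»).  THEOREMS ONLY (no definition, no named fact, no instance, no `sorry`); generic topological-group cohomology over any
coefficient ring `R` (integer multiples are the `zsmul` of the additive groups throughout).

For topological `G`-representations `X, X′` over `R`, a normal subgroup `N`, an `N`-morphism `λ : X|_N → X′|_N`, `g ∈ G` and `u ∈ ℤ` with
`λ(g·v) = u·(g·λ v)` (i.e. `X` is `X′` twisted by a character with value `u` at `g`, as far as `λ` sees):
* `cohomologyMap_two_eq_zsmul_of_hom_eq` — if `λ′ = u·λ` pointwise then `H²(λ′) = u·H²(λ)`;
* **`cohomologyMap_conjMap_two_of_twist`** — `H²(λ)(g · y) = u · (g · H²(λ) y)` (tree `cohomologyMap_conjMap` with the conjugate morphism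
  `λᵍ = g⁻¹ ∘ λ ∘ g = u·λ`);
* **`conjMap_two_eq_zsmul_of_twist`** — if moreover `H²(λ)` is injective and `g` acts trivially on `H²(N, X′)`, then `g · y = u · y` on `H²(N, X)`.

HONEST FRAMING: bookkeeping; no class field theory is proved here; no summit statement is proved by this seat.

## References
* J.-P. Serre, *Local Fields* (1979), VII §5 Prop. 3 (the `G/H`-module `H^q(H, A)`). [SerreLocalFields1979]
* J. Neukirch, A. Schmidt, K. Wingberg, *Cohomology of Number Fields* (2008), I §5 (conjugation `σ_*`), (7.1.4). [NeukirchSchmidtWingberg2008]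
-/

noncomputable section

open CategoryTheory Function

universe v

namespace Literature.NumberTheory.GaloisRepresentations

open _root_.TopRep _root_.ContinuousCohomology

universe u

variable {R : Type u} [CommRing R] [TopologicalSpace R]
variable {G : Type v} [Group G] [TopologicalSpace G] [IsTopologicalGroup G]
variable (X X' : TopRep.{v} R G) (N : Subgroup G) [N.Normal] [LocallyCompactSpace N]

omit [N.Normal] in
/-- `H²(λ′) = u · H²(λ)` when `λ′ = u · λ` pointwise (`u ∈ ℤ`; on explicit `2`-cocycles the pull-back along `λ′` is `u` times the pull-back along `λ`).
[cite: SerreLocalFields1979, VII §5] -/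
theorem cohomologyMap_two_eq_zsmul_of_hom_eq (lam lam' : subgroupRep X N ⟶ subgroupRep X' N) (u : ℤ) (hlam' : ∀ v, lam'.hom v = u • lam.hom v)
    (y : continuousCohomology 2 (subgroupRep X N)) :
    cohomologyMap lam' 2 y = u • cohomologyMap lam 2 y := by
  obtain ⟨c, rfl⟩ := twoCocycleClass_surjective _ y
  rw [cohomologyMap_twoCocycleClass, cohomologyMap_twoCocycleClass, ← twoCocycleClassₗ_apply, ← twoCocycleClassₗ_apply, ← map_zsmul]
  congr 1
  refine Subtype.ext (ContinuousMap.ext fun q => ?_)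
  obtain ⟨σ, τ⟩ := q
  rw [pullback₂_id_resIdHom_apply, hlam', AddSubgroupClass.coe_zsmul, ContinuousMap.zsmul_apply, pullback₂_id_resIdHom_apply]

omit [TopologicalSpace G] [IsTopologicalGroup G] [LocallyCompactSpace ↥N] in
/-- The conjugate `λᵍ = g⁻¹ ∘ λ ∘ g : X|_N → X′|_N` of an `N`-morphism is an `N`-morphism (`N` normal). [cite: SerreLocalFields1979, VII §5] -/
theorem exists_hom_conj (lam : subgroupRep X N ⟶ subgroupRep X' N) (g : G) :
    ∃ lam' : subgroupRep X N ⟶ subgroupRep X' N, ∀ v, lam'.hom v = X'.ρ g⁻¹ (lam.hom (X.ρ g v)) := by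
  refine ⟨TopRep.ofHom ⟨(X'.ρ g⁻¹).comp (lam.hom.toContinuousLinearMap.comp (X.ρ g)), fun x => ?_⟩, fun _ => rfl⟩
  refine ContinuousLinearMap.ext fun w => ?_
  change X'.ρ g⁻¹ (lam.hom (X.ρ g (X.ρ (x : G) w))) = X'.ρ (x : G) (X'.ρ g⁻¹ (lam.hom (X.ρ g w)))
  have hx : g * (x : G) = (g * (x : G) * g⁻¹) * g := by group
  have hmem : g * (x : G) * g⁻¹ ∈ N := Subgroup.Normal.conj_mem inferInstance (x : G) x.2 g
  rw [← ρ_mul_apply, hx, ρ_mul_apply]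
  have hcomm := TopRep.hom_comm_apply lam ⟨g * (x : G) * g⁻¹, hmem⟩ (X.ρ g w)
  change lam.hom (X.ρ (g * (x : G) * g⁻¹) (X.ρ g w)) = X'.ρ (g * (x : G) * g⁻¹) (lam.hom (X.ρ g w)) at hcomm
  rw [hcomm, ← ρ_mul_apply, ← ρ_mul_apply]
  congr 1
  group

/-- **The twisted conjugation law**: for an `N`-morphism `λ : X|_N → X′|_N`, `g ∈ G` and `u ∈ ℤ` with `λ(g·v) = u·(g·λ v)` for all `v`,
`H²(λ)(g · y) = u · (g · H²(λ) y)` on `H²(N, X)`. [cite: SerreLocalFields1979, VII §5 Prop. 3] [cite: NeukirchSchmidtWingberg2008, I §5] -/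
theorem cohomologyMap_conjMap_two_of_twist (lam : subgroupRep X N ⟶ subgroupRep X' N) (g : G) (u : ℤ)
    (htwist : ∀ v, lam.hom (X.ρ g v) = u • X'.ρ g (lam.hom v)) (y : continuousCohomology 2 (subgroupRep X N)) :
    cohomologyMap lam 2 (conjMap X N g 2 y) = u • conjMap X' N g 2 (cohomologyMap lam 2 y) := by
  obtain ⟨lam', hlam'⟩ := exists_hom_conj X X' N lam g
  rw [cohomologyMap_conjMap N lam lam' g hlam' 2 y, cohomologyMap_two_eq_zsmul_of_hom_eq X X' N lam lam' u (fun w => by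
    rw [hlam', htwist, map_zsmul, ρ_inv_apply_ρ_apply]) y, map_zsmul]

/-- **`g · y = u · y` on `H²(N, X)` for a twist `X` of `X′` on which `g` acts trivially**: if `λ : X|_N → X′|_N` is an `N`-morphism with
`λ(g·v) = u·(g·λ v)`, `H²(λ)` is injective, and `g` acts trivially on `H²(N, X′)`, then `conj_g y = u · y` for every `y ∈ H²(N, X)`.  (Use: `X′ = μ_{p^k}`
over an open subgroup of `Γ_{K_v}` — `Gal(K̄_v/K_v)` acts trivially on `Br(L)[p^k]` — and `X = μ_{p^k} ⊗ θ′` with `θ′` trivial on the subgroup,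
`u = θ′(g) = ±1`.) [cite: SerreLocalFields1979, VII §5 Prop. 3] [cite: NeukirchSchmidtWingberg2008, (7.1.4)] -/
theorem conjMap_two_eq_zsmul_of_twist (lam : subgroupRep X N ⟶ subgroupRep X' N) (g : G) (u : ℤ)
    (htwist : ∀ v, lam.hom (X.ρ g v) = u • X'.ρ g (lam.hom v))
    (hinj : Function.Injective (cohomologyMap lam 2))
    (htriv : ∀ z : continuousCohomology 2 (subgroupRep X' N), conjMap X' N g 2 z = z)
    (y : continuousCohomology 2 (subgroupRep X N)) :
    conjMap X N g 2 y = u • y := by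
  apply hinj
  rw [cohomologyMap_conjMap_two_of_twist X X' N lam g u htwist, htriv, map_zsmul]

end Literature.NumberTheory.GaloisRepresentations

end
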